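/-
Copyright (c) 2026 the pub-hodgecm-mathlib formalisation cell (harness21).  Prover seat hodgecm-mathlib-LH7-p09 (g2), CLOSE-OUT ROSTER strike line L3∕L5 (Track A
«(D-RAM) FOUR-FRAME» squad F0∕P3c∕LH4 ∕ F0∕P3c∕LH7); β₂-BOARD v2 row (OFF) «every cone cell off the diagonal row pays 0» (lead LH7-p09 (g2); assembler LH4-p12 (g8)
`cellDiff_offRow_eq_zero_of_pieces`, sockets (E0) and (Dg)); helper lane on h413 = stmt-HodgeConjecture-24833 (count-neutral).  2026-09-04.
-/
import Summits.HodgeConjecture.HodgeConjecture.Theorems.F0P3cDyRamFarConeCellEmpty   -- ★ p862671 (this seat): `v_sub_map_div_eq_of_primitive`, the FAR∕HIGH lemmas; brings ★ p862572 coordinates, ★ DEFS, ★ p862037 transports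
import HarnessLib

/-!
# Crux `H413`, line LH4 «(D-RAM) FOUR-FRAME» — the (β₂) road (R-36), β₂-BOARD v2 row (OFF) (sub-dealer LH4-p04 (g9), WORDS #6∕#9): «THE SUB-DIAGONAL CONE CELLS AND THE HIGH
# DIAGONAL CONE CELLS ARE EMPTY» — sockets (E0) and (Dg) of LH4-p12 (g8)'s `cellDiff_offRow_eq_zero_of_pieces` (any `q`, any `d`)

Cell `hodgecm-mathlib` (D-0151), FLOOR 0, crux item H413 = `stmt-HodgeConjecture-24833`, route of record `HCCMUnconditional`; squads F0∕P3c∕LH4 ∕ LH7; lane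
`--supports stmt-HodgeConjecture-24833 --as helper` (count-neutral; pays NO tier-0 row).  THEOREMS ONLY (no `def`, no instance, no notation, no `sorry`, default heartbeats);
★-only imports; states NO law; (β₂) stays a HYPOTHESIS.  DATUM-FREE: ★ DEFS `levelSet` ∕ `levelSetDep` ∕ `IsOrd` ∕ `dualGen` over the line model `(M, jE, ρ, Θ, α)`.

WHY (the (OFF) cut adopted by LH4-p04 (g9) WORD #6, assembled by LH4-p12 (g8)).  Two of the five sockets are EMPTINESS statements this seat owes:
* §1 (E0) `levelSet_eq_empty_of_lt` — a SUB-DIAGONAL cone cell `j < b` (`1 ≤ b`, `|α − ρα| = 1`) is empty already as a LEVEL SET: for `Y ∈ 𝒪_j` with `|Y| = |ϖE|^b`,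
  `|Y − ρY| ≤ |Y| = |ϖE|^b ≤ |ϖE|^{j+1}`, so `Y∕ϖE ∈ 𝒪_j` and Gram-primitivity `Y∕ϖE ∉ 𝒪_j` fails (★ DEFS `mem_levelSet_iff`).  `levelSetDep ⊆ levelSet` makes the cone cell empty.
* §2 (Dg, `m₀ < jl′`) `not_isOrd_div_of_high'` ∕ `levelSetDep_eq_empty_of_high'` — ★ p862671 `…_of_high` with the conductor letter relaxed to `|cc| ≤ |ϖE|^b` (`b ≤ j`): the strict
  inequality was used nowhere in its proof, so the DIAGONAL cell `j = b` above the row (`|ϖE|^{2b} < |μ|`) and left of the upper line (`|μ − ρμ|·|ϖE|^b < |ϖE^j(α − ρα)|·|μ|`, i.e.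
  `m₀ < jl′` at `j = b`) is EMPTY like the high cells.  (At `jl′ = m₀` the diagonal above the row IS the upper line `j − b = jl′ − m₀ = 0` — populated and balanced in LH4-cdis1's
  key (8,8): cells (5,10), (6,12) — and belongs to socket (U), not here.)
HONEST LABEL.  Count-neutral valuation algebra; nothing printed is asserted; no census law is stated; `HC_CM` is proved only modulo the 7 printed citations (2 remaining named inputs:
hLiu418 = `stmt-HodgeConjecture-24832`, h413 = `stmt-HodgeConjecture-24833`) until rung 0 closes.
## References
* [Serre1979] J.-P. Serre, *Local Fields*, GTM 67 (1979): Ch. III §6 Prop. 12 (orders of conductor `c`).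
* [Kottwitz1986BaseChangeUnits] R. E. Kottwitz, *Base change for unit elements of Hecke algebras*, Compositio Math. 60 (1986): §1 pp. 240–241 (the depth-refined cells).
* [Jacobowitz1962] R. Jacobowitz, *Hermitian forms over local fields*, Amer. J. Math. 84 (1962): §4 (duals, gluing).
* [Rogawski1990] J. D. Rogawski, *Automorphic Representations of Unitary Groups in Three Variables*, Ann. of Math. Stud. 123 (1990): §4.9 Prop. 4.9.1 (b) p. 55.
-/

set_option autoImplicit false

noncomputable section

namespace Summit.HodgeConjecture.HodgeConjecture.Cruxes.H413.F0P3cDyRamDiagonalConeCellEmpty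

open scoped Valued WithZero
open WithZero
open Summit.HodgeConjecture.HodgeConjecture.Cruxes.H413.F0P3cDyRamToricCensusDefs
open Summit.HodgeConjecture.HodgeConjecture.Cruxes.H413.F0P3cDyRamBoundaryCellLetterCardTwo (v_map_lt_one_iff_of_le_iff)
open Summit.HodgeConjecture.HodgeConjecture.Cruxes.H413.F0P3cDyRamTerminalCellOffShellCardTwo (mul_map_sub_mul_map_eq)
open Summit.HodgeConjecture.HodgeConjecture.Cruxes.H413.F0P3cDyRamFarConeCellEmpty (v_sub_map_div_eq_of_primitive)

variable {E M : Type} [Field E] [Valued E ℤᵐ⁰] [Field M] [Valued M ℤᵐ⁰] {ρ Θ : M →+* M} {α : M}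

/-! ## §1 (E0) — a sub-diagonal cone cell is empty as a level set -/

/-- **(E0) «A SUB-DIAGONAL CONE CELL IS EMPTY».**  `ρ` isometric and fixing `ϖE = jE ϖ`, `|ϖ| = exp(−1)`, `|jE c| ≤ 1 ↔ |c| ≤ 1`, `|α − ρα| = 1` (the type-A∕B line model);
`1 ≤ b`, `j < b`.  THEN `levelSet ρ Θ α ϖE h j b = ∅`: a member's dual generator `Y` would have `|Y − ρY| ≤ |Y| = |ϖE|^b ≤ |ϖE^j(α − ρα)|·|ϖE|`, so `Y∕ϖE ∈ 𝒪_j` — but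
members are Gram-primitive. [cite: Serre1979, Ch. III §6 Prop. 12] [cite: Jacobowitz1962, §4] -/
theorem levelSet_eq_empty_of_lt
    (hvρ : ∀ x, Valued.v (ρ x) = Valued.v x) (jE : E →+* M) (hjv : ∀ c, Valued.v (jE c) ≤ 1 ↔ Valued.v c ≤ 1)
    {ϖ : E} (hϖ : Valued.v ϖ = exp (-1 : ℤ)) (hρϖ : ρ (jE ϖ) = jE ϖ) (hU1 : Valued.v (α - ρ α) = 1)
    (h : M) {j b : ℕ} (hb1 : 1 ≤ b) (hjb : j < b) :
    levelSet ρ Θ α (jE ϖ) h j b = ∅ := by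
  have hvϖ0 : Valued.v ϖ ≠ 0 := by rw [hϖ]; exact exp_ne_zero
  have hϖ0 : ϖ ≠ 0 := fun h0 => hvϖ0 (by rw [h0, map_zero])
  have hϖlt : Valued.v ϖ < 1 := by rw [hϖ, ← exp_zero, exp_lt_exp]; norm_num
  have hjϖ0 : jE ϖ ≠ 0 := (map_ne_zero jE).2 hϖ0
  have hvjϖ0 : Valued.v (jE ϖ) ≠ 0 := (Valuation.ne_zero_iff _).2 hjϖ0
  have hvjϖpos : 0 < Valued.v (jE ϖ) := zero_lt_iff.2 hvjϖ0
  have hjϖle : Valued.v (jE ϖ) ≤ 1 := ((v_map_lt_one_iff_of_le_iff jE hjv ϖ).2 hϖlt).le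
  refine Set.subset_empty_iff.1 fun Λ hΛ => ?_
  rw [mem_levelSet_iff] at hΛ
  obtain ⟨x₀, -, -, -, hyp, hylev⟩ := hΛ
  refine hyp ⟨?_, ?_⟩
  · rw [Valuation.map_div, hylev, div_le_one₀ hvjϖpos]
    calc Valued.v (jE ϖ) ^ b ≤ Valued.v (jE ϖ) ^ 1 := pow_le_pow_right_of_le_one' hjϖle hb1
      _ = Valued.v (jE ϖ) := pow_one _
  · rw [map_div₀, hρϖ, ← sub_div, Valuation.map_div, div_le_iff₀ hvjϖpos, Valuation.map_mul, hU1, mul_one, Valuation.map_pow,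
      ← pow_succ]
    refine (Valuation.map_sub _ _ _).trans ?_
    rw [hvρ, max_self, hylev]
    exact pow_le_pow_right_of_le_one' hjϖle (by omega)

/-- **(E0), CELL FORM**: the depth-refined sub-diagonal cone cell is empty, `levelSetDep ρ Θ α ϖE h j b μ = ∅` for `j < b`, `1 ≤ b` (`levelSetDep ⊆ levelSet`).
[cite: Kottwitz1986BaseChangeUnits, §1 pp. 240–241] [cite: Serre1979, Ch. III §6 Prop. 12] -/
theorem levelSetDep_eq_empty_of_lt
    (hvρ : ∀ x, Valued.v (ρ x) = Valued.v x) (jE : E →+* M) (hjv : ∀ c, Valued.v (jE c) ≤ 1 ↔ Valued.v c ≤ 1)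
    {ϖ : E} (hϖ : Valued.v ϖ = exp (-1 : ℤ)) (hρϖ : ρ (jE ϖ) = jE ϖ) (hU1 : Valued.v (α - ρ α) = 1)
    (h : M) {j b : ℕ} (hb1 : 1 ≤ b) (hjb : j < b) (μ : M) :
    levelSetDep ρ Θ α (jE ϖ) h j b μ = ∅ :=
  Set.subset_empty_iff.1 ((levelSetDep_subset ρ Θ α (jE ϖ) h j b μ).trans (levelSet_eq_empty_of_lt hvρ jE hjv hϖ hρϖ hU1 h hb1 hjb).subset)

/-! ## §2 (Dg) — the high DIAGONAL cone cell is empty (★ p862671 `…_of_high` with `|cc| ≤ |ϖE|^b`) -/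

/-- **(Dg) HIGH, DIAGONAL INCLUDED (the `A·Q` term dominates; `|cc| ≤ |ϖE|^b`).**  Letters of ★ p862671 `v_sub_map_div_eq_of_primitive` (`ρ` involution fixing `jE(E)`,
`hEval`, `cc` fixed non-zero, `Y` Gram-primitive) + `ρ` isometric, `|α| ≤ 1`; CELL `|Y| = |ϖE|^b` with `1 ≤ b` and `|cc| ≤ |ϖE|^b` (the diagonal `j = b` allowed — the strict
letter of ★ `not_isOrd_div_of_high` is used nowhere in its proof); HIGH letters `|ϖE|^{2b} < |μ|` and `|μ − ρμ|·|ϖE|^b < |cc(α − ρα)|·|μ|`.  THEN `¬ IsOrd ρ α cc (μ∕Y)`.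
[cite: Kottwitz1986BaseChangeUnits, §1 pp. 240–241] [cite: Serre1979, Ch. III §6 Prop. 12] -/
theorem not_isOrd_div_of_high'
    (hρρ : ∀ x, ρ (ρ x) = x) (hvρ : ∀ x, Valued.v (ρ x) = Valued.v x) (hα : ρ α ≠ α) (hα1 : Valued.v α ≤ 1)
    (jE : E →+* M) (hjv : ∀ c, Valued.v (jE c) ≤ 1 ↔ Valued.v c ≤ 1) (hjfix : ∀ z, ρ z = z ↔ ∃ c, jE c = z)
    {ϖ : E} (hϖ : Valued.v ϖ = exp (-1 : ℤ))
    (hEval : ∀ c : M, ρ c = c → c ≠ 0 → Valued.v c ≤ 1 → ∃ n : ℕ, Valued.v c = Valued.v (jE ϖ) ^ n)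
    {cc : M} (hc : ρ cc = cc) (hc0 : cc ≠ 0) {Y : M} (hYO : IsOrd ρ α cc Y) (hYp : ¬ IsOrd ρ α cc (Y / jE ϖ))
    {b : ℕ} (hb1 : 1 ≤ b) (hYb : Valued.v Y = Valued.v (jE ϖ) ^ b) (hcb : Valued.v cc ≤ Valued.v (jE ϖ) ^ b)
    {μ : M} (h3 : Valued.v (jE ϖ) ^ (2 * b) < Valued.v μ) (h4 : Valued.v (μ - ρ μ) * Valued.v (jE ϖ) ^ b < Valued.v (cc * (α - ρ α)) * Valued.v μ) :
    ¬ IsOrd ρ α cc (μ / Y) := by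
  intro hO
  have hα0 : α - ρ α ≠ 0 := sub_ne_zero.2 (Ne.symm hα)
  have hvα0 : Valued.v (α - ρ α) ≠ 0 := (Valuation.ne_zero_iff _).2 hα0
  have hvαpos : 0 < Valued.v (α - ρ α) := zero_lt_iff.2 hvα0
  have hvϖ0 : Valued.v ϖ ≠ 0 := by rw [hϖ]; exact exp_ne_zero
  have hϖ0 : ϖ ≠ 0 := fun h0 => hvϖ0 (by rw [h0, map_zero])
  have hϖlt : Valued.v ϖ < 1 := by rw [hϖ, ← exp_zero, exp_lt_exp]; norm_num
  have hjϖ0 : jE ϖ ≠ 0 := (map_ne_zero jE).2 hϖ0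
  have hvjϖ0 : Valued.v (jE ϖ) ≠ 0 := (Valuation.ne_zero_iff _).2 hjϖ0
  have hvjϖpos : 0 < Valued.v (jE ϖ) := zero_lt_iff.2 hvjϖ0
  have hjϖlt : Valued.v (jE ϖ) < 1 := (v_map_lt_one_iff_of_le_iff jE hjv ϖ).2 hϖlt
  have hvc0 : Valued.v cc ≠ 0 := (Valuation.ne_zero_iff _).2 hc0
  have hvcpos : 0 < Valued.v cc := zero_lt_iff.2 hvc0
  have hY0 : Y ≠ 0 := fun h0 => by
    rw [h0, Valuation.map_zero] at hYb
    exact pow_ne_zero b hvjϖ0 hYb.symm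
  have hρY0 : ρ Y ≠ 0 := (map_ne_zero ρ).2 hY0
  have hpbpos : 0 < Valued.v (jE ϖ) ^ b := pow_pos hvjϖpos _
  have hμpos : 0 < Valued.v μ := lt_of_le_of_lt zero_le h3
  have hY1 : Valued.v Y ≤ Valued.v (jE ϖ) := by
    rw [hYb]
    calc Valued.v (jE ϖ) ^ b ≤ Valued.v (jE ϖ) ^ 1 := pow_le_pow_right_of_le_one' hjϖlt.le hb1
      _ = Valued.v (jE ϖ) := pow_one _
  -- coordinates
  set B : M := (μ - ρ μ) / (α - ρ α) with hBdef
  set Q : M := (Y - ρ Y) / (α - ρ α) with hQdef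
  set A : M := μ - B * α with hAdef
  set P : M := Y - Q * α with hPdef
  have hvQ : Valued.v Q = Valued.v cc := v_sub_map_div_eq_of_primitive hρρ hα jE hjv hjfix hϖ hEval hc hc0 hYO hYp hY1
  clear_value A P
  clear_value B Q
  have hvB : Valued.v B * Valued.v (α - ρ α) = Valued.v (μ - ρ μ) := by
    rw [hBdef, Valuation.map_div, div_mul_cancel₀ _ hvα0]
  -- `|B|·|ϖE|^b < |cc|·|μ|` (left of the upper line), hence `|B| < |μ|`
  have hBlt : Valued.v B * Valued.v (jE ϖ) ^ b < Valued.v cc * Valued.v μ := by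
    have h : Valued.v B * Valued.v (jE ϖ) ^ b * Valued.v (α - ρ α) < Valued.v cc * Valued.v μ * Valued.v (α - ρ α) := by
      calc Valued.v B * Valued.v (jE ϖ) ^ b * Valued.v (α - ρ α) = Valued.v (μ - ρ μ) * Valued.v (jE ϖ) ^ b := by rw [mul_right_comm, hvB]
        _ < Valued.v (cc * (α - ρ α)) * Valued.v μ := h4
        _ = Valued.v cc * Valued.v μ * Valued.v (α - ρ α) := by rw [Valuation.map_mul]; ac_rfl
    exact lt_of_mul_lt_mul_right h hvαpos.le
  have hBμ : Valued.v (B * α) < Valued.v μ := by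
    rw [Valuation.map_mul]
    have h : Valued.v B * Valued.v (jE ϖ) ^ b < Valued.v μ * Valued.v (jE ϖ) ^ b :=
      calc Valued.v B * Valued.v (jE ϖ) ^ b < Valued.v cc * Valued.v μ := hBlt
        _ ≤ Valued.v (jE ϖ) ^ b * Valued.v μ := mul_le_mul_left hcb _
        _ = Valued.v μ * Valued.v (jE ϖ) ^ b := mul_comm _ _
    calc Valued.v B * Valued.v α ≤ Valued.v B * 1 := mul_le_mul_right hα1 _
      _ = Valued.v B := mul_one _
      _ < Valued.v μ := lt_of_mul_lt_mul_right h hpbpos.le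
  have hvA : Valued.v A = Valued.v μ := by
    rw [hAdef, sub_eq_add_neg, Valuation.map_add_eq_of_lt_left _ (by rw [Valuation.map_neg]; exact hBμ)]
  have hvP : Valued.v P ≤ Valued.v (jE ϖ) ^ b := by
    rw [hPdef]
    refine (Valuation.map_sub _ _ _).trans (max_le hYb.le ?_)
    rw [Valuation.map_mul, hvQ]
    calc Valued.v cc * Valued.v α ≤ Valued.v cc * 1 := mul_le_mul_right hα1 _
      _ = Valued.v cc := mul_one _
      _ ≤ Valued.v (jE ϖ) ^ b := hcb
  -- dominance `|B P| < |A Q| = |μ|·|cc|`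
  have hAQ : Valued.v (A * Q) = Valued.v μ * Valued.v cc := by rw [Valuation.map_mul, hvA, hvQ]
  have hdom : Valued.v (B * P) < Valued.v (A * Q) := by
    rw [hAQ, Valuation.map_mul]
    calc Valued.v B * Valued.v P ≤ Valued.v B * Valued.v (jE ϖ) ^ b := mul_le_mul_right hvP _
      _ < Valued.v cc * Valued.v μ := hBlt
      _ = Valued.v μ * Valued.v cc := mul_comm _ _
  have hdiff : Valued.v (B * P - A * Q) = Valued.v μ * Valued.v cc := by
    rw [sub_eq_add_neg, add_comm, Valuation.map_add_eq_of_lt_left _ (by rw [Valuation.map_neg]; exact hdom), Valuation.map_neg, hAQ]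
  -- the depth clause bounds `|BP − AQ|·|α − ρα|` by `|cc(α − ρα)|·|Y|²`
  have hident : μ / Y - ρ (μ / Y) = (B * P - A * Q) * (α - ρ α) / (Y * ρ Y) := by
    rw [map_div₀, div_sub_div _ _ hY0 hρY0, mul_map_sub_mul_map_eq hα hBdef hAdef hQdef hPdef]
  have hO2 := hO.2
  rw [hident, Valuation.map_div, Valuation.map_mul, Valuation.map_mul, hvρ, hYb, div_le_iff₀ (mul_pos hpbpos hpbpos), hdiff, Valuation.map_mul] at hO2
  -- contradiction with `h3`
  have hlt : Valued.v μ * Valued.v cc * Valued.v (α - ρ α) < Valued.v μ * Valued.v cc * Valued.v (α - ρ α) :=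
    calc Valued.v μ * Valued.v cc * Valued.v (α - ρ α) ≤ Valued.v cc * Valued.v (α - ρ α) * (Valued.v (jE ϖ) ^ b * Valued.v (jE ϖ) ^ b) := hO2
      _ = Valued.v (jE ϖ) ^ (2 * b) * (Valued.v cc * Valued.v (α - ρ α)) := by rw [two_mul, pow_add]; ac_rfl
      _ < Valued.v μ * (Valued.v cc * Valued.v (α - ρ α)) := mul_lt_mul_of_pos_right h3 (mul_pos hvcpos hvαpos)
      _ = Valued.v μ * Valued.v cc * Valued.v (α - ρ α) := (mul_assoc _ _ _).symm
  exact lt_irrefl _ hlt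

/-- **(Dg) CELL HEAD — «THE HIGH DIAGONAL CONE CELL IS EMPTY»** (★ p862671 `levelSetDep_eq_empty_of_high` with `b ≤ j`): block∕line-model frame + `Fix ρ = jE(E)`, `hEval`;
the cone cell `(j, b)` with `1 ≤ b ≤ j`; HIGH letters `|ϖE|^{2b} < |μ|` (above the row) and `|μ − ρμ|·|ϖE|^b < |ϖE^j(α − ρα)|·|μ|` (left of the upper line; at `j = b`,
`|α − ρα| = 1` this is `m₀ < jl′`).  THEN `levelSetDep ρ Θ α ϖE h j b μ = ∅`. [cite: Kottwitz1986BaseChangeUnits, §1 pp. 240–241] [cite: Jacobowitz1962, §4] [cite: Serre1979, Ch. III §6 Prop. 12] -/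
theorem levelSetDep_eq_empty_of_high'
    (hρρ : ∀ x, ρ (ρ x) = x) (hvρ : ∀ x, Valued.v (ρ x) = Valued.v x) (hα : ρ α ≠ α) (hα1 : Valued.v α ≤ 1)
    (hint : ∀ z : M, Valued.v z ≤ 1 → Valued.v ((z - ρ z) / (α - ρ α)) ≤ 1)
    (hΘΘ : ∀ x, Θ (Θ x) = x) (hΘρ : ∀ x, Θ (ρ x) = ρ (Θ x)) (hvΘ : ∀ x, Valued.v (Θ x) = Valued.v x)
    (jE : E →+* M) (hjv : ∀ c, Valued.v (jE c) ≤ 1 ↔ Valued.v c ≤ 1) (hjfix : ∀ z, ρ z = z ↔ ∃ c, jE c = z)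
    {ϖ : E} (hϖ : Valued.v ϖ = exp (-1 : ℤ))
    (hEval : ∀ c : M, ρ c = c → c ≠ 0 → Valued.v c ≤ 1 → ∃ n : ℕ, Valued.v c = Valued.v (jE ϖ) ^ n)
    {h : M} (hh : h ≠ 0) {j b : ℕ} (hb1 : 1 ≤ b) (hbj : b ≤ j) {μ : M}
    (h3 : Valued.v (jE ϖ) ^ (2 * b) < Valued.v μ) (h4 : Valued.v (μ - ρ μ) * Valued.v (jE ϖ) ^ b < Valued.v (jE ϖ ^ j * (α - ρ α)) * Valued.v μ) :
    levelSetDep ρ Θ α (jE ϖ) h j b μ = ∅ := by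
  have hvϖ0 : Valued.v ϖ ≠ 0 := by rw [hϖ]; exact exp_ne_zero
  have hϖ0 : ϖ ≠ 0 := fun h0 => hvϖ0 (by rw [h0, map_zero])
  have hϖlt : Valued.v ϖ < 1 := by rw [hϖ, ← exp_zero, exp_lt_exp]; norm_num
  have hjϖ0 : jE ϖ ≠ 0 := (map_ne_zero jE).2 hϖ0
  have hjϖlt : Valued.v (jE ϖ) < 1 := (v_map_lt_one_iff_of_le_iff jE hjv ϖ).2 hϖlt
  have hρϖ : ρ (jE ϖ) = jE ϖ := (hjfix _).2 ⟨ϖ, rfl⟩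
  have hc : ρ (jE ϖ ^ j) = jE ϖ ^ j := by rw [map_pow, hρϖ]
  have hc0 : jE ϖ ^ j ≠ 0 := pow_ne_zero j hjϖ0
  have hc1 : Valued.v (jE ϖ ^ j) ≤ 1 := by rw [Valuation.map_pow]; exact pow_le_one₀ zero_le hjϖlt.le
  have hcb : Valued.v (jE ϖ ^ j) ≤ Valued.v (jE ϖ) ^ b := by
    rw [Valuation.map_pow]; exact pow_le_pow_right_of_le_one' hjϖlt.le hbj
  refine Set.subset_empty_iff.1 fun Λ hΛ => ?_
  rw [mem_levelSetDep_iff, mem_levelSet_iff] at hΛ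
  obtain ⟨⟨x₀, hx₀, hΛx, hyO, hyp, hylev⟩, hdep⟩ := hΛ
  have hO := (forall_herm_mul_mem_iff_isOrd_div hρρ hvρ hα hα1 hint hΘΘ hΘρ hvΘ hc hc0 hc1 hh hx₀ hΛx μ).1 hdep
  exact not_isOrd_div_of_high' hρρ hvρ hα hα1 jE hjv hjfix hϖ hEval hc hc0 hyO hyp hb1 hylev hcb h3 h4 hO

end Summit.HodgeConjecture.HodgeConjecture.Cruxes.H413.F0P3cDyRamDiagonalConeCellEmpty

end
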